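import Literature.Analysis.FluidPDE.NSVorticityEnergy
import Literature.Analysis.FluidPDE.SverakLandauBernoulliAlgebra
import Literature.Analysis.FluidPDE.SverakLandauBernoulliCalculus
import HarnessLib

/-!
# Šverák's classification of `(−1)`-homogeneous steady Navier–Stokes flows — the identity for `K`

Analysis/FluidPDE support file, fifth of the series `SverakLandau*` proving the named fact
`Literature.Analysis.FluidPDE.Sverak2011_landauClassification` (V. Šverák, J. Math. Sci. 179
(2011) = arXiv:math/0604550, Thm. 1).

Setting of this file: `U : ℝ^ι → ℝ^ι`, `P : ℝ^ι → ℝ` globally smooth (in the application: the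
cut-off regularisations of Šverák's `u`, `p`, `SverakLandauRegularize`) and an open set `S` on
which the steady Navier–Stokes equations `−ΔU + (U·∇)U + ∇P = 0`, `div U = 0` and Euler's
relation `DU(y) y = −U(y)` (infinitesimal `(−1)`-homogeneity) hold.  We derive on `S`, in the
coordinates `∂ₗ = pderiv l` of `CoordDerivatives`:

* the equations in coordinates (`Sverak2011.pderiv_pressure_eq_on`,
  `Sverak2011.sum_pderiv_comp_eq_zero_on`);
* Euler's relations for `Uᵢ`, `∂ₗUᵢ`, `∂ₖ∂ₗUᵢ` (degrees `−1, −2, −3`) and for `∂ᵢP` (degree `−3`,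
  read off from the equations) — whence the homogeneous pressure representative
  `P₂ = −½ ∑ⱼ yⱼ∂ⱼP` has the same first and second partials as `P` on `S`
  (`Sverak2011.pderiv_P₂_eq_on`, `Sverak2011.pderiv_pderiv_P₂_eq_on`);
* the pressure Poisson equation `∑ₗ ∂ₗ∂ₗP = −∑ₗⱼ ∂ₗUⱼ∂ⱼUₗ` on `S`
  (`Sverak2011.sum_pderiv_pderiv_pressure_on`; cf. the global version
  `IsLerayProfile.sum_pderiv_pderiv_pressure` of `TsaiHeadPressure`);
* and, for `ι = Fin 3`, **the pointwise identity for the Bernoulli function**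
  `K = |y|²(½|U|² + P₂) − ½⟪y, U⟫² − ⟪y, U⟫` (`= ½|v|² + p − f` on `S²`, the quantity Šverák shows
  to be constant in §4):

    `∑ₗ ∂ₗ∂ₗK − ∑ₗ Uₗ ∂ₗK = ⟪y, curl U⟫²`  on `S`   (`Sverak2011.bernoulliK_identity_on`),

  by feeding the product-rule expressions of `SverakLandauBernoulliCalculus` and the relations
  above into the finite-sum lemma `Sverak2011.bernoulliK_algebra`.  In the next file the strong
  maximum principle turns this into `K ≡ const`, `⟪x, curl u⟫ ≡ 0` — Šverák's Lemma 1 and the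
  Bernoulli relation of §4, without the Fredholm alternative used in print.

## References

* V. Šverák, *On Landau's solutions of the Navier–Stokes equations*, J. Math. Sci. 179 (2011)
  208–228, arXiv:math/0604550, §4 (Lemma 1; `½|v|² + p − f = c`). [`Sverak2011`]
* T.-P. Tsai, ARMA 143 (1998) 29–51, (1.7), (2.1). [`Tsai1998`]
-/

noncomputable section

open Set Filter
open scoped Topology BigOperators ContDiff Laplacian RealInnerProductSpace

namespace Literature.Analysis.FluidPDE

namespace Sverak2011

variable {ι : Type*} [Fintype ι] [DecidableEq ι]

section Relations

variable {U : EuclideanSpace ℝ ι → EuclideanSpace ℝ ι} {P : EuclideanSpace ℝ ι → ℝ}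
  {S : Set (EuclideanSpace ℝ ι)}

/-- **The steady Navier–Stokes equations in coordinates** on `S`:
`∂ᵢP = ∑ⱼ ∂ⱼ∂ⱼUᵢ − ∑ⱼ Uⱼ∂ⱼUᵢ` (Šverák's (1.1) with `ν = 1`). [cite: Sverak2011, §1 (1.1)] -/
theorem pderiv_pressure_eq_on (hU : ContDiff ℝ ∞ U)
    (hns : ∀ y ∈ S, -(Δ U) y + convect U U y + gradient P y = 0) {y : EuclideanSpace ℝ ι}
    (hy : y ∈ S) (i : ι) :
    pderiv i P y = ∑ j, pderiv j (pderiv j fun z => U z i) y -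
      ∑ j, U y j * pderiv j (fun z => U z i) y := by
  have hm := congrArg (fun w : EuclideanSpace ℝ ι => w i) (hns y hy)
  have hdiff : DifferentiableAt ℝ U y := (hU.differentiable (by simp)) y
  simp only [PiLp.add_apply, PiLp.neg_apply, PiLp.zero_apply] at hm
  rw [laplacian_apply_comp (hU.of_le (by norm_cast)), convect_apply_comp hdiff,
    gradient_apply_comp] at hm
  linarith

/-- Incompressibility in coordinates on `S`: `∑ᵢ ∂ᵢUᵢ = 0`. [cite: Sverak2011, §1 (1.1)] -/
theorem sum_pderiv_comp_eq_zero_on (hU : ContDiff ℝ ∞ U)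
    (hdiv : ∀ y ∈ S, VectorCalculus.divergence U y = 0) {y : EuclideanSpace ℝ ι} (hy : y ∈ S) :
    ∑ i, pderiv i (fun z => U z i) y = 0 := by
  rw [← divergence_eq_sum_pderiv ((hU.differentiable (by simp)) y)]
  exact hdiv y hy

/-- Euler's relation for the components: `∑ⱼ yⱼ ∂ⱼUᵢ = −Uᵢ` on `S`. [folklore] -/
theorem euler_comp_on (hU : ContDiff ℝ ∞ U) (hEu : ∀ y ∈ S, fderiv ℝ U y y = -U y)
    {y : EuclideanSpace ℝ ι} (hy : y ∈ S) (i : ι) :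
    ∑ j, y j * pderiv j (fun z => U z i) y = (-1) * U y i :=
  sum_mul_pderiv_comp_eq ((hU.differentiable (by simp)) y) (by rw [hEu y hy, neg_one_smul]) i

/-- Euler's relation for the first derivatives: `∑ⱼ yⱼ ∂ⱼ(∂ₗUᵢ) = −2 ∂ₗUᵢ` on `S`. [folklore] -/
theorem euler_pderiv_comp_on (hU : ContDiff ℝ ∞ U) (hS : IsOpen S)
    (hEu : ∀ y ∈ S, fderiv ℝ U y y = -U y) {y : EuclideanSpace ℝ ι} (hy : y ∈ S) (l i : ι) :
    ∑ j, y j * pderiv j (pderiv l fun z => U z i) y = (-2) * pderiv l (fun z => U z i) y := by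
  have h := euler_pderiv (contDiff_comp_of_contDiff hU i) hS (k := -1)
    (fun z hz => euler_comp_on hU hEu hz i) l hy
  rw [h]; norm_num

/-- Euler's relation for the second derivatives: `∑ⱼ yⱼ ∂ⱼ(∂ₖ∂ₗUᵢ) = −3 ∂ₖ∂ₗUᵢ` on `S`. [folklore] -/
theorem euler_pderiv_pderiv_comp_on (hU : ContDiff ℝ ∞ U) (hS : IsOpen S)
    (hEu : ∀ y ∈ S, fderiv ℝ U y y = -U y) {y : EuclideanSpace ℝ ι} (hy : y ∈ S) (k l i : ι) :
    ∑ j, y j * pderiv j (pderiv k (pderiv l fun z => U z i)) y =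
      (-3) * pderiv k (pderiv l fun z => U z i) y := by
  have h := euler_pderiv (contDiff_pderiv_comp hU l i) hS (k := -2)
    (fun z hz => euler_pderiv_comp_on hU hS hEu hz l i) k hy
  rw [h]; norm_num

/-- The partial derivative `∂ⱼ` of the right-hand side `Rᵢ = ∑ₖ ∂ₖ∂ₖUᵢ − ∑ₘ Uₘ∂ₘUᵢ` of the
pressure-gradient formula. [folklore] -/
theorem pderiv_pressureRHS (hU : ContDiff ℝ ∞ U) (j i : ι) (y : EuclideanSpace ℝ ι) :
    pderiv j (fun z => ∑ k, pderiv k (pderiv k fun w => U w i) z -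
      ∑ m, U z m * pderiv m (fun w => U w i) z) y =
      ∑ k, pderiv j (pderiv k (pderiv k fun w => U w i)) y -
        ∑ m, (pderiv j (fun w => U w m) y * pderiv m (fun w => U w i) y +
          U y m * pderiv j (pderiv m fun w => U w i) y) := by
  have h1 : Differentiable ℝ fun z => ∑ k, pderiv k (pderiv k fun w => U w i) z :=
    Differentiable.fun_sum fun k _ => differentiable_pderiv_pderiv_comp hU k k i
  have h2 : Differentiable ℝ fun z => ∑ m, U z m * pderiv m (fun w => U w i) z :=
    Differentiable.fun_sum fun m _ => (differentiable_comp hU m).mul (differentiable_pderiv_comp hU m i)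
  rw [pderiv_sub (f := fun z => ∑ k, pderiv k (pderiv k fun w => U w i) z)
      (g := fun z => ∑ m, U z m * pderiv m (fun w => U w i) z) h1 h2,
    pderiv_sum (f := fun k z => pderiv k (pderiv k fun w => U w i) z) _
      (fun k _ => differentiable_pderiv_pderiv_comp hU k k i),
    pderiv_sum (f := fun m z => U z m * pderiv m (fun w => U w i) z) _
      (fun m _ => (differentiable_comp hU m).mul (differentiable_pderiv_comp hU m i))]
  beta_reduce
  congr 1
  refine Finset.sum_congr rfl fun m _ => ?_
  rw [pderiv_mul (differentiable_comp hU m) (differentiable_pderiv_comp hU m i)]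

/-- **Euler's relation for the pressure gradient**: `∑ⱼ yⱼ ∂ⱼ(∂ᵢP) = −3 ∂ᵢP` on `S` (the
pressure gradient `∇P = ΔU − (U·∇)U` is homogeneous of degree `−3`). [folklore] -/
theorem euler_pderiv_pressure_on (hU : ContDiff ℝ ∞ U) (hS : IsOpen S)
    (hns : ∀ y ∈ S, -(Δ U) y + convect U U y + gradient P y = 0)
    (hEu : ∀ y ∈ S, fderiv ℝ U y y = -U y) {y : EuclideanSpace ℝ ι} (hy : y ∈ S) (i : ι) :
    ∑ j, y j * pderiv j (pderiv i P) y = (-3) * pderiv i P y := by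
  have hEq : EqOn (pderiv i P) (fun z => ∑ k, pderiv k (pderiv k fun w => U w i) z -
      ∑ m, U z m * pderiv m (fun w => U w i) z) S :=
    fun z hz => pderiv_pressure_eq_on hU hns hz i
  have hj : ∀ j, pderiv j (pderiv i P) y =
      ∑ k, pderiv j (pderiv k (pderiv k fun w => U w i)) y -
        ∑ m, (pderiv j (fun w => U w m) y * pderiv m (fun w => U w i) y +
          U y m * pderiv j (pderiv m fun w => U w i) y) := fun j => by
    rw [pderiv_eqOn hS hEq j hy, pderiv_pressureRHS hU j i y]
  simp only [hj, mul_sub, Finset.sum_sub_distrib, Finset.mul_sum, mul_add,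
    Finset.sum_add_distrib]
  -- exchange the order of summation and use Euler's relations of degrees −3, −1, −2
  have hA : ∑ j, ∑ k, y j * pderiv j (pderiv k (pderiv k fun w => U w i)) y =
      ∑ k, (-3) * pderiv k (pderiv k fun w => U w i) y := by
    rw [Finset.sum_comm]
    exact Finset.sum_congr rfl fun k _ => euler_pderiv_pderiv_comp_on hU hS hEu hy k k i
  have hB : ∑ j, ∑ m, y j * (pderiv j (fun w => U w m) y * pderiv m (fun w => U w i) y) =
      ∑ m, (-1) * U y m * pderiv m (fun w => U w i) y := by
    rw [Finset.sum_comm]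
    refine Finset.sum_congr rfl fun m _ => ?_
    rw [← euler_comp_on hU hEu hy m, Finset.sum_mul]
    exact Finset.sum_congr rfl fun j _ => by ring
  have hC : ∑ j, ∑ m, y j * (U y m * pderiv j (pderiv m fun w => U w i) y) =
      ∑ m, U y m * ((-2) * pderiv m (fun w => U w i) y) := by
    rw [Finset.sum_comm]
    refine Finset.sum_congr rfl fun m _ => ?_
    rw [← euler_pderiv_comp_on hU hS hEu hy m i, Finset.mul_sum]
    exact Finset.sum_congr rfl fun j _ => by ring
  rw [hA, hB, hC, pderiv_pressure_eq_on hU hns hy i]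
  have e1 : ∑ k, (-3) * pderiv k (pderiv k fun w => U w i) y =
      (-3) * ∑ k, pderiv k (pderiv k fun w => U w i) y := by rw [Finset.mul_sum]
  have e2 : ∑ m, (-1) * U y m * pderiv m (fun w => U w i) y +
      ∑ m, U y m * ((-2) * pderiv m (fun w => U w i) y) =
      (-3) * ∑ m, U y m * pderiv m (fun w => U w i) y := by
    rw [Finset.mul_sum, ← Finset.sum_add_distrib]
    exact Finset.sum_congr rfl fun m _ => by ring
  rw [e1, e2]
  ring

/-- **The homogeneous pressure has the same gradient**: with `P₂ = −½∑ⱼ yⱼ∂ⱼP`,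
`∂ₗP₂ = ∂ₗP` on `S` (since `∇P` is homogeneous of degree `−3`). [folklore] -/
theorem pderiv_P₂_eq_on (hU : ContDiff ℝ ∞ U) (hP : ContDiff ℝ ∞ P) (hS : IsOpen S)
    (hns : ∀ y ∈ S, -(Δ U) y + convect U U y + gradient P y = 0)
    (hEu : ∀ y ∈ S, fderiv ℝ U y y = -U y) {P₂ : EuclideanSpace ℝ ι → ℝ}
    (hP₂ : P₂ = fun y => -(2⁻¹ * ∑ j, y j * pderiv j P y)) (l : ι) :
    EqOn (pderiv l P₂) (pderiv l P) S := by
  intro y hy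
  have hE : Differentiable ℝ fun y => ∑ j, y j * pderiv j P y :=
    (contDiff_eulerP hP).differentiable (by simp)
  rw [hP₂, pderiv_neg, pderiv_const_mul (f := fun y => ∑ j, y j * pderiv j P y) hE,
    pderiv_eulerP hP l]
  beta_reduce
  have hcomm : ∀ j, pderiv l (pderiv j P) y = pderiv j (pderiv l P) y := fun j => by
    rw [pderiv_comm hP l j]
  simp only [hcomm]
  rw [euler_pderiv_pressure_on hU hS hns hEu hy l]
  ring

/-- `∂ₖ∂ₗP₂ = ∂ₖ∂ₗP` on `S`. [folklore] -/
theorem pderiv_pderiv_P₂_eq_on (hU : ContDiff ℝ ∞ U) (hP : ContDiff ℝ ∞ P) (hS : IsOpen S)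
    (hns : ∀ y ∈ S, -(Δ U) y + convect U U y + gradient P y = 0)
    (hEu : ∀ y ∈ S, fderiv ℝ U y y = -U y) {P₂ : EuclideanSpace ℝ ι → ℝ}
    (hP₂ : P₂ = fun y => -(2⁻¹ * ∑ j, y j * pderiv j P y)) (k l : ι) :
    EqOn (pderiv k (pderiv l P₂)) (pderiv k (pderiv l P)) S :=
  pderiv_eqOn hS (pderiv_P₂_eq_on hU hP hS hns hEu hP₂ l) k

/-- Derivatives of the incompressibility constraint on `S`: `∑ₗ ∂ⱼ∂ₗUₗ = 0`. [folklore] -/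
theorem sum_pderiv_pderiv_comp_eq_zero_on (hU : ContDiff ℝ ∞ U) (hS : IsOpen S)
    (hdiv : ∀ y ∈ S, VectorCalculus.divergence U y = 0) {y : EuclideanSpace ℝ ι} (hy : y ∈ S)
    (j : ι) : ∑ l, pderiv j (pderiv l fun z => U z l) y = 0 := by
  have h0 : ∀ z ∈ S, (fun z => ∑ l, pderiv l (fun w => U w l) z) z = 0 :=
    fun z hz => sum_pderiv_comp_eq_zero_on hU hdiv hz
  have := pderiv_eq_zero_of_eqOn_zero hS h0 j hy
  rwa [pderiv_sum (f := fun l z => pderiv l (fun w => U w l) z) _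
    (fun l _ => differentiable_pderiv_comp hU l l)] at this

/-- Second derivatives of the incompressibility constraint on `S`: `∑ₗ ∂ₖ∂ₖ∂ₗUₗ = 0`. [folklore] -/
theorem sum_pderiv_pderiv_pderiv_comp_eq_zero_on (hU : ContDiff ℝ ∞ U) (hS : IsOpen S)
    (hdiv : ∀ y ∈ S, VectorCalculus.divergence U y = 0) {y : EuclideanSpace ℝ ι} (hy : y ∈ S)
    (k : ι) : ∑ l, pderiv k (pderiv k (pderiv l fun z => U z l)) y = 0 := by
  have h0 : ∀ z ∈ S, (fun z => ∑ l, pderiv k (pderiv l fun w => U w l) z) z = 0 :=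
    fun z hz => sum_pderiv_pderiv_comp_eq_zero_on hU hS hdiv hz k
  have := pderiv_eq_zero_of_eqOn_zero hS h0 k hy
  rwa [pderiv_sum (f := fun l z => pderiv k (pderiv l fun w => U w l) z) _
    (fun l _ => differentiable_pderiv_pderiv_comp hU k l l)] at this

/-- **Pressure Poisson equation on `S`**: `∑ₗ ∂ₗ∂ₗP = −∑ₗⱼ ∂ₗUⱼ ∂ⱼUₗ` (take `∂ₗ` of the `l`-th
equation and sum; the viscous and convective third-order terms drop out by incompressibility;
Tsai 1998, (2.1)). [cite: Tsai1998, (2.1)] -/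
theorem sum_pderiv_pderiv_pressure_on (hU : ContDiff ℝ ∞ U) (hS : IsOpen S)
    (hns : ∀ y ∈ S, -(Δ U) y + convect U U y + gradient P y = 0)
    (hdiv : ∀ y ∈ S, VectorCalculus.divergence U y = 0) {y : EuclideanSpace ℝ ι} (hy : y ∈ S) :
    ∑ l, pderiv l (pderiv l P) y =
      -∑ l, ∑ j, pderiv l (fun z => U z j) y * pderiv j (fun z => U z l) y := by
  have hl : ∀ l, pderiv l (pderiv l P) y =
      ∑ k, pderiv l (pderiv k (pderiv k fun w => U w l)) y -
        ∑ m, (pderiv l (fun w => U w m) y * pderiv m (fun w => U w l) y +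
          U y m * pderiv l (pderiv m fun w => U w l) y) := fun l => by
    have hEq : EqOn (pderiv l P) (fun z => ∑ k, pderiv k (pderiv k fun w => U w l) z -
        ∑ m, U z m * pderiv m (fun w => U w l) z) S :=
      fun z hz => pderiv_pressure_eq_on hU hns hz l
    rw [pderiv_eqOn hS hEq l hy, pderiv_pressureRHS hU l l y]
  simp only [hl, Finset.sum_sub_distrib, Finset.sum_add_distrib]
  -- the third-order viscous term: `∑ₗ∑ₖ ∂ₗ∂ₖ∂ₖUₗ = ∑ₖ ∂ₖ∂ₖ(div U) = 0`
  have h3 : ∑ l, ∑ k, pderiv l (pderiv k (pderiv k fun w => U w l)) y = 0 := by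
    rw [Finset.sum_comm]
    refine Finset.sum_eq_zero fun k _ => ?_
    have hc : ∀ l, pderiv l (pderiv k (pderiv k fun w => U w l)) =
        pderiv k (pderiv k (pderiv l fun w => U w l)) := fun l => by
      rw [pderiv_comm (contDiff_pderiv_comp hU k l) l k, pderiv_comm (contDiff_comp_of_contDiff hU l) l k]
    simp only [hc]
    exact sum_pderiv_pderiv_pderiv_comp_eq_zero_on hU hS hdiv hy k
  -- the convective third-order term: `∑ₗ∑ₘ Uₘ ∂ₗ∂ₘUₗ = ∑ₘ Uₘ ∂ₘ(div U) = 0`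
  have h4 : ∑ l, ∑ m, U y m * pderiv l (pderiv m fun w => U w l) y = 0 := by
    rw [Finset.sum_comm]
    refine Finset.sum_eq_zero fun m _ => ?_
    have hc : ∀ l, pderiv l (pderiv m fun w => U w l) = pderiv m (pderiv l fun w => U w l) :=
      fun l => pderiv_comm (contDiff_comp_of_contDiff hU l) l m
    simp only [hc]
    rw [← Finset.mul_sum, sum_pderiv_pderiv_comp_eq_zero_on hU hS hdiv hy m, mul_zero]
  rw [h3, h4]
  ring

end Relations

/-! ### The identity for `K` in dimension three -/

section Three

variable {U : EuclideanSpace ℝ (Fin 3) → EuclideanSpace ℝ (Fin 3)} {P : EuclideanSpace ℝ (Fin 3) → ℝ}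
  {S : Set (EuclideanSpace ℝ (Fin 3))} {r2 U2 F P₂ K : EuclideanSpace ℝ (Fin 3) → ℝ}

/-- **The Bernoulli-function identity** (the `ℝ³ ∖ {0}` form of `−Δ_{S²}K + v·∇K = −ω²` for
Šverák's Bernoulli quantity `K = ½|v|² + p − f`, §4).  Let `U`, `P` be smooth and satisfy on the
open set `S ⊆ ℝ³` the steady Navier–Stokes equations, incompressibility and Euler's relation
`DU(y) y = −U(y)`.  Then with `F = ⟪y, U⟫`, `P₂ = −½∑ⱼ yⱼ∂ⱼP` and
`K = |y|²(½|U|² + P₂) − ½F² − F`, at every `y ∈ S`: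
`∑ₗ ∂ₗ∂ₗK(y) − ∑ₗ Uₗ(y) ∂ₗK(y) = ⟪y, curl U(y)⟫²` (the right-hand side written out in the partials
`∂ⱼUᵢ`). [cite: Sverak2011, §4 Lemma 1] -/
theorem bernoulliK_identity_on (hU : ContDiff ℝ ∞ U) (hP : ContDiff ℝ ∞ P) (hS : IsOpen S)
    (hns : ∀ y ∈ S, -(Δ U) y + convect U U y + gradient P y = 0)
    (hdiv : ∀ y ∈ S, VectorCalculus.divergence U y = 0)
    (hEu : ∀ y ∈ S, fderiv ℝ U y y = -U y)
    (hr2 : r2 = fun y => ∑ i, y i ^ 2) (hU2 : U2 = fun y => ∑ i, U y i ^ 2)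
    (hF : F = fun y => ∑ i, y i * U y i) (hP₂ : P₂ = fun y => -(2⁻¹ * ∑ j, y j * pderiv j P y))
    (hK : K = fun y => r2 y * (2⁻¹ * U2 y + P₂ y) - 2⁻¹ * F y ^ 2 - F y)
    {y : EuclideanSpace ℝ (Fin 3)} (hy : y ∈ S) :
    ∑ l, pderiv l (pderiv l K) y - ∑ l, U y l * pderiv l K y =
      (y 0 * (pderiv 1 (fun z => U z 2) y - pderiv 2 (fun z => U z 1) y) +
        y 1 * (pderiv 2 (fun z => U z 0) y - pderiv 0 (fun z => U z 2) y) +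
        y 2 * (pderiv 0 (fun z => U z 1) y - pderiv 1 (fun z => U z 0) y)) ^ 2 := by
  have hK₁ := fun l => congrFun (pderiv_bernoulliK hU hP hr2 hU2 hF hP₂ hK l) y
  have hK₂ := fun l => congrFun (pderiv_pderiv_bernoulliK hU hP hr2 hU2 hF hP₂ hK l) y
  simp only [pderiv_P₂_eq_on hU hP hS hns hEu hP₂ _ hy,
    pderiv_pderiv_P₂_eq_on hU hP hS hns hEu hP₂ _ _ hy] at hK₁ hK₂
  refine bernoulliK_algebra (fun i => y i) (fun i => U y i) (fun l => pderiv l P y)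
    (fun l => pderiv l (pderiv l P) y) (fun i => ∑ l, pderiv l (pderiv l fun z => U z i) y)
    (fun l => U y l + ∑ i, y i * pderiv l (fun z => U z i) y)
    (fun l => 2 * pderiv l (fun z => U z l) y + ∑ i, y i * pderiv l (pderiv l fun z => U z i) y)
    (fun l => pderiv l K y) (fun l => pderiv l (pderiv l K) y)
    (fun j i => pderiv j (fun z => U z i) y) (fun l i => pderiv l (pderiv l fun z => U z i) y)
    (P₂ y) (r2 y) (U2 y) (F y)
    (fun i => pderiv_pressure_eq_on hU hns hy i) (fun i => rfl)
    (sum_pderiv_comp_eq_zero_on hU hdiv hy)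
    (fun i => by rw [euler_comp_on hU hEu hy i, neg_one_mul])
    (by rw [hP₂]; ring)
    (sum_pderiv_pderiv_pressure_on hU hS hns hdiv hy)
    (by rw [hr2]) (by rw [hU2]) (by rw [hF]) (fun l => rfl) (fun l => rfl)
    (fun l => by rw [hK₁ l]) (fun l => by rw [hK₂ l])

/-- **The radial-profile algebra.** With the symbols of `bernoulliK_algebra` (steady equations,
incompressibility, `P = P₂(x) = −½∑ⱼ xⱼ∂ⱼP`), the product-rule expressions `F₁ l = ∂ₗF`,
`F₂ l = ∂ₗ∂ₗF` of `F = ⟪x, u⟫` satisfy `−∑ₗ F₂ l + ∑ₗ uₗ F₁ l = |u|² + 2P` — the bulk form of the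
second equation of Šverák's sphere system (S), `−Δf + v∇f − f² − |v|² − 2p = 0`
(Šverák 2011, §4 (S) and Appendix 1). [cite: Sverak2011, §4 (S)] -/
theorem radialF_algebra (x u p₁ lap F₁ F₂ : Fin 3 → ℝ) (d dd : Fin 3 → Fin 3 → ℝ) (P U2 : ℝ)
    (hNS : ∀ i, p₁ i = lap i - ∑ j, u j * d j i)
    (hlap : ∀ i, lap i = ∑ l, dd l i)
    (hdiv : ∑ l, d l l = 0)
    (hEP : ∑ j, x j * p₁ j = -2 * P)
    (hU2 : U2 = ∑ i, u i ^ 2)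
    (hF₁ : ∀ l, F₁ l = u l + ∑ i, x i * d l i)
    (hF₂ : ∀ l, F₂ l = 2 * d l l + ∑ i, x i * dd l i) :
    -∑ l, F₂ l + ∑ l, u l * F₁ l = U2 + 2 * P := by
  simp only [Fin.sum_univ_three] at hNS hlap hdiv hEP hU2 hF₁ hF₂ ⊢
  simp only [hF₁, hF₂]
  simp only [hNS, hlap] at hEP
  subst hU2
  have hP : P = -2⁻¹ * (x 0 * (dd 0 0 + dd 1 0 + dd 2 0 -
      (u 0 * d 0 0 + u 1 * d 1 0 + u 2 * d 2 0)) +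
      x 1 * (dd 0 1 + dd 1 1 + dd 2 1 - (u 0 * d 0 1 + u 1 * d 1 1 + u 2 * d 2 1)) +
      x 2 * (dd 0 2 + dd 1 2 + dd 2 2 - (u 0 * d 0 2 + u 1 * d 1 2 + u 2 * d 2 2))) := by
    linarith [hEP]
  subst hP
  have hd00 : d 0 0 = -d 1 1 - d 2 2 := by linarith [hdiv]
  simp only [hd00]
  ring

/-- **The radial-profile identity** (bulk form of the `f`-equation of Šverák's sphere system (S),
`−Δf + v∇f = f² + |v|² + 2p`, §4): for `U`, `P` smooth satisfying the steady equations and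
incompressibility on the open set `S ⊆ ℝ³`, with `F = ⟪y, U⟫` and `P₂ = −½∑ⱼ yⱼ∂ⱼP`,
`−∑ₗ ∂ₗ∂ₗF(y) + ∑ₗ Uₗ(y)∂ₗF(y) = |U(y)|² + 2P₂(y)` at every `y ∈ S` (in the bulk variables
`f² + |v|²` becomes `|U|²`). [cite: Sverak2011, §4 (S)] -/
theorem radialF_identity_on (hU : ContDiff ℝ ∞ U)
    (hns : ∀ y ∈ S, -(Δ U) y + convect U U y + gradient P y = 0)
    (hdiv : ∀ y ∈ S, VectorCalculus.divergence U y = 0)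
    (hF : F = fun y => ∑ i, y i * U y i) (hP₂ : P₂ = fun y => -(2⁻¹ * ∑ j, y j * pderiv j P y))
    {y : EuclideanSpace ℝ (Fin 3)} (hy : y ∈ S) :
    -∑ l, pderiv l (pderiv l F) y + ∑ l, U y l * pderiv l F y =
      ∑ i, U y i ^ 2 + 2 * P₂ y := by
  have hF₁ : ∀ l, pderiv l F y = U y l + ∑ i, y i * pderiv l (fun z => U z i) y := fun l => by
    rw [hF, pderiv_radial hU l]
  have hF₂ : ∀ l, pderiv l (pderiv l F) y =
      2 * pderiv l (fun z => U z l) y + ∑ i, y i * pderiv l (pderiv l fun z => U z i) y := by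
    intro l
    rw [hF, pderiv_radial hU l, pderiv_pderiv_radial hU l]
  exact radialF_algebra (fun i => y i) (fun i => U y i) (fun l => pderiv l P y)
    (fun i => ∑ l, pderiv l (pderiv l fun z => U z i) y)
    (fun l => pderiv l F y) (fun l => pderiv l (pderiv l F) y)
    (fun j i => pderiv j (fun z => U z i) y) (fun l i => pderiv l (pderiv l fun z => U z i) y)
    (P₂ y) (∑ i, U y i ^ 2)
    (fun i => pderiv_pressure_eq_on hU hns hy i) (fun i => rfl)
    (sum_pderiv_comp_eq_zero_on hU hdiv hy) (by rw [hP₂]; ring) rfl hF₁ hF₂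

end Three

end Sverak2011

end Literature.Analysis.FluidPDE
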